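import Mathlib

/-!
# The key coefficient inequality of the AP theorem for `1 + f·g`

Context (solo-blind programme on Valiant's hypothesis, rung (R₃) "real roots of `f g + 1`",
WALL §4.10 (4g), claim T153).  For a real trinomial `f = Σ aᵢ x^{αᵢ}` (normalised so that
`α₁ = 0 ≤ α₂ ≤ α₃`) and a polynomial `g` with positive coefficients, Pólya's iterated Rolle
argument bounds the number of positive roots of `1 + f g` by `3 + Z(P₃)`, where `P₃` is an
explicit exponential sum whose coefficients are indexed by 3-element multisets of exponents
of `g`.  For two exponents `y < x` of `g` the `{y,x,x}`-coefficient is, up to the positive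
factor `C_y C_x²`, the polynomial `apCoeff y x α₂ α₃` below.  The theorem `apCoeff_neg`
— negativity in the sub-doubling regime `y < x ≤ 2y` — is exactly what makes Descartes'
rule give `Z(P₃) ≤ 4` when the exponents of a positive trinomial `g` are in arithmetic
progression, whence `1 + f g` has at most `7 < 9` positive roots (the AP theorem, T153).
Only the algebraic inequality is formalised here.
-/

namespace Summit.ValiantsHypothesis.SoloBlind

/-- The `{y,x,x}`-coefficient of the third Pólya–Rolle form `P₃` of `1 + f g`, divided by the
positive factor `C_y C_x²`: `D (2x − 3y − α₃) − B (2x − y + α₃)` with `D = x (x + α₂)` and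
`B = y (2x − y + α₂) + x (2y − x + α₂)` (normalisation `α₁ = 0`). -/
def apCoeff (y x a₂ a₃ : ℝ) : ℝ :=
  x * (x + a₂) * (2 * x - 3 * y - a₃)
    - (y * (2 * x - y + a₂) + x * (2 * y - x + a₂)) * (2 * x - y + a₃)

/-- The algebraic identity used in the proof:
`apCoeff = (4x³ − 12x²y + 6xy² − y³) + α₂ (y² − 4xy) − α₃ (D + B)`. -/
theorem apCoeff_eq (y x a₂ a₃ : ℝ) :
    apCoeff y x a₂ a₃
      = (4 * x ^ 3 - 12 * x ^ 2 * y + 6 * x * y ^ 2 - y ^ 3) + a₂ * (y ^ 2 - 4 * x * y)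
        - a₃ * (x * (x + a₂) + (y * (2 * x - y + a₂) + x * (2 * y - x + a₂))) := by
  unfold apCoeff; ring

/-- The cubic `4r³ − 12r² + 6r − 1` is negative on `1 < r ≤ 2`, in homogeneous form:
for `0 < y < x ≤ 2y`, `4x³ − 12x²y + 6xy² − y³ < 0`. -/
theorem apCubic_neg {y x : ℝ} (hy : 0 < y) (hyx : y < x) (hx2 : x ≤ 2 * y) :
    4 * x ^ 3 - 12 * x ^ 2 * y + 6 * x * y ^ 2 - y ^ 3 < 0 := by
  have hd : 0 < x - y := by linarith
  have hdy : x - y ≤ y := by linarith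
  -- with d = x - y:  4x³ − 12x²y + 6xy² − y³ = −3y³ − 6y²d + 4d³  and  d³ ≤ d·y²
  have hid : 4 * x ^ 3 - 12 * x ^ 2 * y + 6 * x * y ^ 2 - y ^ 3
      = -(3 * y ^ 3) - 6 * y ^ 2 * (x - y) + 4 * (x - y) ^ 3 := by ring
  have h1 : (x - y) ^ 3 ≤ (x - y) * y ^ 2 := by
    have h2 : (x - y) ^ 2 ≤ y ^ 2 := by nlinarith
    have : (x - y) ^ 3 = (x - y) * (x - y) ^ 2 := by ring
    rw [this]
    exact mul_le_mul_of_nonneg_left h2 hd.le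
  rw [hid]
  nlinarith [mul_pos (mul_pos hy hy) hd, pow_pos hy 3]

/-- KEY INEQUALITY OF THE AP THEOREM (T153): in the sub-doubling regime `0 < y < x ≤ 2y`, with
`0 ≤ α₂` and `0 ≤ α₃`, the `{y,x,x}`-coefficient of `P₃` is negative. -/
theorem apCoeff_neg {y x a₂ a₃ : ℝ} (hy : 0 < y) (hyx : y < x) (hx2 : x ≤ 2 * y)
    (ha₂ : 0 ≤ a₂) (ha₃ : 0 ≤ a₃) : apCoeff y x a₂ a₃ < 0 := by
  have hx : 0 < x := by linarith
  have hq := apCubic_neg hy hyx hx2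
  have hB : 0 ≤ y * (2 * x - y + a₂) + x * (2 * y - x + a₂) := by
    have h1 : 0 ≤ y * (2 * x - y + a₂) := mul_nonneg hy.le (by linarith)
    have h2 : 0 ≤ x * (2 * y - x + a₂) := mul_nonneg hx.le (by linarith)
    linarith
  have hD : 0 ≤ x * (x + a₂) := mul_nonneg hx.le (by linarith)
  have ha2t : a₂ * (y ^ 2 - 4 * x * y) ≤ 0 := by
    have : y ^ 2 - 4 * x * y ≤ 0 := by nlinarith
    exact mul_nonpos_of_nonneg_of_nonpos ha₂ this
  have h3 : 0 ≤ a₃ * (x * (x + a₂) + (y * (2 * x - y + a₂) + x * (2 * y - x + a₂))) :=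
    mul_nonneg ha₃ (by linarith)
  rw [apCoeff_eq]
  linarith

/-- The general (un-normalised) form: for exponents `α₁ ≤ α₂`, `α₁ ≤ α₃` of `f` and terms
`y < x` of `g` with `0 < y + α₁` and `x − y ≤ y + α₁`, the `{y,x,x}`-coefficient
`(x+α₁)(x+α₂)(2x−3y−α₃) − [(y+α₁)(2x−y+α₂) + (x+α₁)(2y−x+α₂)](2x−y+α₃)` is negative
(substitute `y ↦ y+α₁`, `x ↦ x+α₁`, `αᵢ ↦ αᵢ−α₁`). -/
theorem apCoeff_neg_general {y x a₁ a₂ a₃ : ℝ} (hy : 0 < y + a₁) (hyx : y < x)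
    (hx2 : x - y ≤ y + a₁) (ha₂ : a₁ ≤ a₂) (ha₃ : a₁ ≤ a₃) :
    (x + a₁) * (x + a₂) * (2 * x - 3 * y - a₃)
      - ((y + a₁) * (2 * x - y + a₂) + (x + a₁) * (2 * y - x + a₂)) * (2 * x - y + a₃) < 0 := by
  have h := apCoeff_neg (y := y + a₁) (x := x + a₁) (a₂ := a₂ - a₁) (a₃ := a₃ - a₁)
    hy (by linarith) (by linarith) (by linarith) (by linarith)
  unfold apCoeff at h
  have hid : (x + a₁) * (x + a₂) * (2 * x - 3 * y - a₃)
      - ((y + a₁) * (2 * x - y + a₂) + (x + a₁) * (2 * y - x + a₂)) * (2 * x - y + a₃)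
      = (x + a₁) * ((x + a₁) + (a₂ - a₁)) * (2 * (x + a₁) - 3 * (y + a₁) - (a₃ - a₁))
        - ((y + a₁) * (2 * (x + a₁) - (y + a₁) + (a₂ - a₁))
            + (x + a₁) * (2 * (y + a₁) - (x + a₁) + (a₂ - a₁))) * (2 * (x + a₁) - (y + a₁) + (a₃ - a₁)) := by
    ring
  rw [hid]; exact h

end Summit.ValiantsHypothesis.SoloBlind
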